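import Summits.AtomisticToContinuum.BoseEinsteinCondensation.Theorems.BECThomsonPrincipleGDTransferSeededPlainInteractionInt
import Summits.AtomisticToContinuum.BoseEinsteinCondensation.Theorems.BECThomsonPrincipleGDTransferSeededPlainPairCost
import Summits.AtomisticToContinuum.BoseEinsteinCondensation.Theorems.BECThomsonPrincipleGDTransferSeededPlainPairAlgebra

/-!
# Route `BECThomsonPrinciple`, crux `GDTransfer` (stmt-AtomisticToContinuum-9482), line `seeded-continuity`:
# stub `stub_bandEmptinessInt`, part 4 — algebra and second variation of the plain pair, INTEGRABLE profile

Support file (part 4) of the registered stub `stub_bandEmptinessInt` of skeleton v7, continuing parts 1–3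
(`…SeededPlainFormsInt`, `…SeededPlainPairsInt`, `…SeededPlainInteractionInt`).  Twins (suffix `_int`) of the two
remaining consumers of boundedness in the plain-pair chain of `stub_bandEmptinessBdd` (`…SeededPlainPairCostBdd`), with
`∀ r ≥ 0, v r ≤ B` replaced by finiteness on `[0, ∞)`, `∀ r ≥ 0, v r < ∞`, and integrability of the lift,
`‖v‖₁ = ∫_{ℝ³} v(|x|) dx < ∞` (what an admissible square-integrable profile of skeleton v7 has, `lintegral_le_of_sq`):
* `plainPair_apriori_int` / `plainPairAlgebra_int` — (A1)–(A4) of `PlainPairAlgebra` for an admissible profile with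
  integrable lift: `plainPair_apriori_bdd` used boundedness only through `∫_{ℝ³} v < ∞`, the zero-defect half
  `plainPair_zeroDefect` never mentions the profile's regularity;
* `plainPairCost_int` — the conclusion of `PlainPairCost` (the Kennedy–Lieb–Shastry second variation of the plain pair
  at near-minimisers, `𝓔(ζ₊) + 𝓔(ζ₋) ≤ E₀(‖ζ₊‖² + ‖ζ₋‖²) + (5k² + c₂ρ)(1 + ‖ζ₊‖² + ‖ζ₋‖²)`): the proof of
  `plainPairCost_bdd` verbatim over the landed `PlainCost.core_estimate` (measurable `v`) and the exact kinetic identity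
  `plainKineticIdentity`, fed with `plainInteractionBound_int` (part 3) instead of `plainInteractionBound_bdd`
  (registered helper statement `plainPairCostInt_cost`).
All [folklore] (KennedyLiebShastry1988 (12)–(14); PitaevskiiStringari1991; arXiv:1211.2778 §2; LSSY2005 App. A).
-/

noncomputable section

open MeasureTheory Filter
open scoped ENNReal NNReal ComplexConjugate

namespace Summit.AtomisticToContinuum.BoseEinsteinCondensation.Cruxes.GDTransfer.Seeded

open Literature.MathematicalPhysics.QuantumManyBody.BoseGas
open Summit.AtomisticToContinuum.BoseEinsteinCondensation.Theorems.GaussianDominationCan.Negative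
open Summit.AtomisticToContinuum.BoseEinsteinCondensation.Cruxes.GDTransfer.DysonDressedWitness

/-! ## (A1)–(A4) of the plain pair for an admissible profile with integrable lift -/

/-- **(A1)+(A2) for an admissible profile with integrable lift**: the plain pair `ζ₊ = plainUp n Ψ`,
`ζ₋ = plainDown n Ψ` are directions and at every `(N, L)` one radius `R₀` bounds their masses and, with the factor
`(1 + ‖n‖²)(E(Ψ) + 1)`, their energy forms (`PlainAlgebra.exists_apriori_const` needs only `∫ v < ∞`). [folklore] -/
theorem plainPair_apriori_int {v : ℝ → ℝ≥0∞} (hv : IsRepulsiveFiniteRange v)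
    (hint : (∫⁻ x : Space, v ‖x‖) ≠ ⊤) (m : ℕ) {L : ℝ} (hL : 0 < L) :
    ∃ R₀ : ℝ, 0 < R₀ ∧ ∀ (n : Fin 3 → ℤ) (Ψ : PeriodicTrialState (m + 1) L),
      IsDirection m L (plainUp m L n Ψ.ψ) ∧ IsDirection m L (plainDown m L n Ψ.ψ) ∧
      mass L (plainUp m L n Ψ.ψ) ≤ ENNReal.ofReal R₀ ∧ mass L (plainDown m L n Ψ.ψ) ≤ ENNReal.ofReal R₀ ∧
      eform v L (plainUp m L n Ψ.ψ) ≤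
        ENNReal.ofReal (R₀ * (1 + ‖(fun j => (n j : ℝ))‖ ^ 2)) * (periodicEnergy v Ψ + 1) ∧
      eform v L (plainDown m L n Ψ.ψ) ≤
        ENNReal.ofReal (R₀ * (1 + ‖(fun j => (n j : ℝ))‖ ^ 2)) * (periodicEnergy v Ψ + 1) := by
  -- adapted from `plainPair_apriori_bdd` (bounded profile)
  obtain ⟨C, hCtop, hC⟩ := PlainAlgebra.exists_apriori_const (L := L) hL hv.1 hint m
  refine ⟨C.toReal + 1, by positivity, fun p Ψ => ?_⟩
  obtain ⟨h1, h2, h3, h4⟩ := hC p Ψ.ψ Ψ.contDiff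
  rw [mass_trialState Ψ, mul_one] at h1 h2 h3 h4
  rw [eform_trialState v Ψ] at h3 h4
  have hCle : C ≤ ENNReal.ofReal (C.toReal + 1) := by
    rw [ENNReal.ofReal_add ENNReal.toReal_nonneg zero_le_one, ENNReal.ofReal_toReal hCtop]
    exact le_self_add
  have hform : ∀ {e : ℝ≥0∞},
      e ≤ C * (periodicEnergy v Ψ + (1 + ENNReal.ofReal (‖(fun j => (p j : ℝ))‖ ^ 2))) →
        e ≤ ENNReal.ofReal ((C.toReal + 1) * (1 + ‖(fun j => (p j : ℝ))‖ ^ 2)) *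
          (periodicEnergy v Ψ + 1) := by
    intro e he
    refine he.trans ?_
    rw [ENNReal.ofReal_mul (by positivity), ENNReal.ofReal_add zero_le_one (sq_nonneg _),
      ENNReal.ofReal_one, mul_assoc]
    refine mul_le_mul' hCle ?_
    rw [mul_add, mul_one]
    refine add_le_add ?_ le_rfl
    calc periodicEnergy v Ψ = 1 * periodicEnergy v Ψ := (one_mul _).symm
      _ ≤ (1 + ENNReal.ofReal (‖(fun j => (p j : ℝ))‖ ^ 2)) * periodicEnergy v Ψ :=
          mul_le_mul' le_self_add le_rfl
  exact ⟨PlainAlgebra.isDirection_plainUp hL.ne' p (isDirection_trialState Ψ),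
    PlainAlgebra.isDirection_plainDown p (isDirection_trialState Ψ),
    h1.trans hCle, h2.trans hCle, hform h3, hform h4⟩

/-- **`PlainPairAlgebra` for an admissible profile with integrable lift** ((A1)–(A4): directions, budgets, zero defect
against the LNSS source, weighted occupation), the conclusion of `PlainPairAlgebra` with `IsFiniteContinuous v` replaced
by `∫_{ℝ³} v(|x|) dx < ∞`. [folklore] -/
theorem plainPairAlgebra_int {v : ℝ → ℝ≥0∞} (hv : IsRepulsiveFiniteRange v)
    (hint : (∫⁻ x : Space, v ‖x‖) ≠ ⊤) (m : ℕ) {L : ℝ} (hL : 0 < L) :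
    ∃ R₀ : ℝ, 0 < R₀ ∧ ∀ (n : Fin 3 → ℤ) (Ψ : PeriodicTrialState (m + 1) L),
      IsDirection m L (plainUp m L n Ψ.ψ) ∧ IsDirection m L (plainDown m L n Ψ.ψ) ∧
      mass L (plainUp m L n Ψ.ψ) ≤ ENNReal.ofReal R₀ ∧ mass L (plainDown m L n Ψ.ψ) ≤ ENNReal.ofReal R₀ ∧
      eform v L (plainUp m L n Ψ.ψ) ≤
        ENNReal.ofReal (R₀ * (1 + ‖(fun j => (n j : ℝ))‖ ^ 2)) * (periodicEnergy v Ψ + 1) ∧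
      eform v L (plainDown m L n Ψ.ψ) ≤
        ENNReal.ofReal (R₀ * (1 + ‖(fun j => (n j : ℝ))‖ ^ 2)) * (periodicEnergy v Ψ + 1) ∧
      mass L (plainUp m L n Ψ.ψ) + mass L (plainDown m L n Ψ.ψ) ≤
        2 * ENNReal.ofReal (((m + 1 : ℕ) : ℝ) *
          ‖srcPair m L n (plainUp m L n Ψ.ψ) Ψ.ψ + srcPair m L n Ψ.ψ (plainDown m L n Ψ.ψ)‖) ∧
      weightedOcc m L n Ψ.ψ ≤ 2 * mass L (plainDown m L n Ψ.ψ) := by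
  obtain ⟨R₀, hR₀, h⟩ := plainPair_apriori_int hv hint m hL
  refine ⟨R₀, hR₀, fun n Ψ => ?_⟩
  obtain ⟨h1, h2, h3, h4, h5, h6⟩ := h n Ψ
  obtain ⟨h7, h8⟩ := plainPair_zeroDefect m L hL n Ψ
  exact ⟨h1, h2, h3, h4, h5, h6, h7, h8⟩

/-! ## The second variation of the plain pair at near-minimisers, admissible profile finite on `[0, ∞)`, integrable lift -/

/-- **`PlainPairCost` for an admissible profile finite on `[0, ∞)` with integrable lift**: the Kennedy–Lieb–Shastry
second variation of the plain pair at `δ`-near-minimisers,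
`𝓔(ζ₊) + 𝓔(ζ₋) ≤ E₀(‖ζ₊‖² + ‖ζ₋‖²) + (5k² + c₂ρ)(1 + ‖ζ₊‖² + ‖ζ₋‖²)` with `c₂ = C_I(1 + √(‖v‖₁+1)) + 2` and a slack
`δ = δ(v, N, L) > 0` — the proof of `plainPairCost_bdd` verbatim over the exact kinetic identity `plainKineticIdentity`
and `plainInteractionBound_int`. [folklore] -/
theorem plainPairCost_int {v : ℝ → ℝ≥0∞} (hv : IsRepulsiveFiniteRange v) (hfin : ∀ r, 0 ≤ r → v r ≠ ⊤)
    (hint : (∫⁻ x : Space, v ‖x‖) ≠ ⊤) :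
    ∃ c₁ c₂ : ℝ, 0 < c₁ ∧ 0 < c₂ ∧ ∀ (m : ℕ) (L : ℝ), 0 < L →
      periodicGroundStateEnergy v (m + 1) L ≠ ⊤ →
      ∃ δ : ℝ≥0∞, 0 < δ ∧ ∀ Ψ : PeriodicTrialState (m + 1) L,
        periodicEnergy v Ψ ≤ periodicGroundStateEnergy v (m + 1) L + δ →
        ∀ n : Fin 3 → ℤ,
          eform v L (plainUp m L n Ψ.ψ) + eform v L (plainDown m L n Ψ.ψ) ≤
            periodicGroundStateEnergy v (m + 1) L * (mass L (plainUp m L n Ψ.ψ) + mass L (plainDown m L n Ψ.ψ)) +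
              ENNReal.ofReal
                ((c₁ * (2 * Real.pi * ‖(fun j => (n j : ℝ))‖ / L) ^ 2 + c₂ * (((m + 1 : ℕ) : ℝ) / L ^ 3)) *
                  (1 + (mass L (plainUp m L n Ψ.ψ) + mass L (plainDown m L n Ψ.ψ)).toReal)) := by
  -- adapted from `plainPairCost_bdd` (bounded profile)
  have hK : PlainKineticIdentity := plainKineticIdentity
  obtain ⟨C_I, hC_I, hIb⟩ := PlainInteraction.plainInteractionBound_int hv hfin hint
  have hnv : 0 ≤ (∫⁻ x : Space, v ‖x‖).toReal := ENNReal.toReal_nonneg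
  refine ⟨5, C_I * (1 + Real.sqrt ((∫⁻ x : Space, v ‖x‖).toReal + 1)) + 2, by norm_num, by positivity, ?_⟩
  intro m L hL hE0
  obtain ⟨K, hKtop, hKb⟩ := PlainAlgebra.exists_apriori_const (L := L) hL hv.1 hint m
  have he₀ : (periodicGroundStateEnergy v (m + 1) L).toReal ≤
      ((m + 1 : ℕ) : ℝ) ^ 2 / L ^ 3 * (∫⁻ x : Space, v ‖x‖).toReal := by
    have h := ENNReal.toReal_mono (ENNReal.mul_ne_top ENNReal.ofReal_ne_top hint)
      (PlainCost.periodicGroundStateEnergy_le_const hv.1 m hL)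
    rw [ENNReal.toReal_mul, ENNReal.toReal_ofReal (by positivity)] at h
    have hc : ((m + 1 : ℕ) : ℝ) = (m : ℝ) + 1 := by push_cast; ring
    rwa [hc]
  have hN : (0 : ℝ) < ((m + 1 : ℕ) : ℝ) := by positivity
  have hL3 : (0 : ℝ) < L ^ 3 := by positivity
  have hρ : (0 : ℝ) < ((m + 1 : ℕ) : ℝ) / L ^ 3 := div_pos hN hL3
  have hk0 : (0 : ℝ) < (2 * Real.pi / L) ^ 2 := by positivity
  have he₀0 : 0 ≤ (periodicGroundStateEnergy v (m + 1) L).toReal := ENNReal.toReal_nonneg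
  have hKr : 0 ≤ K.toReal := ENNReal.toReal_nonneg
  set ε : ℝ := min (((m + 1 : ℕ) : ℝ) / L ^ 3) ((2 * Real.pi / L) ^ 2) with hεdef
  have hε : 0 < ε := lt_min hρ hk0
  have hερ : ε ≤ ((m + 1 : ℕ) : ℝ) / L ^ 3 := min_le_left _ _
  have hεk : ε ≤ (2 * Real.pi / L) ^ 2 := min_le_right _ _
  set δr : ℝ := min 1 (min (((m + 1 : ℕ) : ℝ) ^ 2 / L ^ 3)
    (ε ^ 2 / (K.toReal ^ 2 * ((periodicGroundStateEnergy v (m + 1) L).toReal + 3) + 1))) with hδrdef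
  have hδr : 0 < δr := lt_min one_pos (lt_min (by positivity) (by positivity))
  have hδ1 : δr ≤ 1 := min_le_left _ _
  have hδN : δr ≤ ((m + 1 : ℕ) : ℝ) ^ 2 / L ^ 3 := (min_le_right _ _).trans (min_le_left _ _)
  have hδε : K.toReal ^ 2 * ((periodicGroundStateEnergy v (m + 1) L).toReal + 3) * δr ≤ ε ^ 2 := by
    have h1 : δr ≤ ε ^ 2 / (K.toReal ^ 2 * ((periodicGroundStateEnergy v (m + 1) L).toReal + 3) + 1) :=
      (min_le_right _ _).trans (min_le_right _ _)
    rw [le_div_iff₀ (by positivity)] at h1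
    linarith only [h1, hδr.le]
  refine ⟨ENNReal.ofReal δr, ENNReal.ofReal_pos.2 hδr, ?_⟩
  intro Ψ hΨ n
  have hψ : IsDirection m L Ψ.ψ := isDirection_trialState Ψ
  have hmass : mass L Ψ.ψ = 1 := mass_trialState Ψ
  have hEtop : periodicEnergy v Ψ ≠ ⊤ :=
    ne_top_of_le_ne_top (ENNReal.add_ne_top.2 ⟨hE0, ENNReal.ofReal_ne_top⟩) hΨ
  have hψe : eform v L Ψ.ψ ≠ ⊤ := by rw [eform_trialState]; exact hEtop
  have h1top : mass L Ψ.ψ ≠ ⊤ := by rw [hmass]; exact ENNReal.one_ne_top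
  have hq0 : 0 ≤ ‖(fun j => (n j : ℝ))‖ ^ 2 := sq_nonneg _
  obtain ⟨hma, hmb, hea, heb⟩ := hKb n Ψ.ψ Ψ.contDiff
  obtain ⟨-, -, -, heDU⟩ := hKb n (plainUp m L n Ψ.ψ) (PlainAlgebra.contDiff_plainUp n Ψ.contDiff)
  obtain ⟨-, -, heUD, -⟩ := hKb n (plainDown m L n Ψ.ψ) (PlainAlgebra.contDiff_plainDown n Ψ.contDiff)
  obtain ⟨hmatop, hMa⟩ := PlainCost.toReal_le_of_le_mul hKtop h1top hma
  obtain ⟨hmbtop, hMb⟩ := PlainCost.toReal_le_of_le_mul hKtop h1top hmb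
  obtain ⟨hae, hEa⟩ := PlainCost.toReal_le_of_le_budget hKtop hψe h1top hq0 hea
  obtain ⟨hbe, hEb⟩ := PlainCost.toReal_le_of_le_budget hKtop hψe h1top hq0 heb
  obtain ⟨hDUe, hEDU⟩ := PlainCost.toReal_le_of_le_budget hKtop hae hmatop hq0 heDU
  obtain ⟨hUDe, hEUD⟩ := PlainCost.toReal_le_of_le_budget hKtop hbe hmbtop hq0 heUD
  rw [hmass, ENNReal.toReal_one, mul_one] at hMa hMb hEa hEb
  rw [eform_trialState v Ψ] at hEa hEb
  have hMa0 : 0 ≤ (mass L (plainUp m L n Ψ.ψ)).toReal := ENNReal.toReal_nonneg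
  have hMb0 : 0 ≤ (mass L (plainDown m L n Ψ.ψ)).toReal := ENNReal.toReal_nonneg
  have hEDU0 : 0 ≤ (eform v L (plainDown m L n (plainUp m L n Ψ.ψ))).toReal := ENNReal.toReal_nonneg
  have hEUD0 : 0 ≤ (eform v L (plainUp m L n (plainDown m L n Ψ.ψ))).toReal := ENNReal.toReal_nonneg
  have hE0' : 0 ≤ (periodicEnergy v Ψ).toReal := ENNReal.toReal_nonneg
  have hEle : (periodicEnergy v Ψ).toReal ≤ (periodicGroundStateEnergy v (m + 1) L).toReal + δr := by
    have h := ENNReal.toReal_mono (ENNReal.add_ne_top.2 ⟨hE0, ENNReal.ofReal_ne_top⟩) hΨ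
    rwa [ENNReal.toReal_add hE0 ENNReal.ofReal_ne_top, ENNReal.toReal_ofReal hδr.le] at h
  have core := PlainCost.core_estimate hK hv.1 hL n hψ hψe hae hbe hUDe hDUe
  rw [hmass, ENNReal.toReal_one, mul_one, eform_trialState v Ψ] at core
  have hint' := (le_abs_self _).trans (hIb m L hL n Ψ hEtop)
  have hS := PlainCost.sum_sq_le_three_mul_norm_sq n
  have hS0 : 0 ≤ ∑ i : Fin 3, ((n i : ℝ)) ^ 2 := Finset.sum_nonneg fun i _ => sq_nonneg _
  refine PlainCost.add_le_of_toReal_le hae hbe hE0 hmatop hmbtop (by positivity) ?_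
  have hk : (2 * Real.pi * ‖(fun j => (n j : ℝ))‖ / L) ^ 2 =
      (2 * Real.pi / L) ^ 2 * ‖(fun j => (n j : ℝ))‖ ^ 2 := by ring
  rw [hk]
  set N : ℝ := ((m + 1 : ℕ) : ℝ) with hNdef
  set nv : ℝ := (∫⁻ x : Space, v ‖x‖).toReal with hnvdef
  set e₀ : ℝ := (periodicGroundStateEnergy v (m + 1) L).toReal with he₀def
  set Kr : ℝ := K.toReal with hKrdef
  set k0 : ℝ := (2 * Real.pi / L) ^ 2 with hk0def
  set ρ : ℝ := N / L ^ 3 with hρdef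
  set E : ℝ := (periodicEnergy v Ψ).toReal with hEdef
  set q : ℝ := ‖(fun j => (n j : ℝ))‖ ^ 2 with hqdef
  set Ma : ℝ := (mass L (plainUp m L n Ψ.ψ)).toReal with hMadef
  set Mb : ℝ := (mass L (plainDown m L n Ψ.ψ)).toReal with hMbdef
  set Ea : ℝ := (eform v L (plainUp m L n Ψ.ψ)).toReal with hEadef
  set Eb : ℝ := (eform v L (plainDown m L n Ψ.ψ)).toReal with hEbdef
  set EDU : ℝ := (eform v L (plainDown m L n (plainUp m L n Ψ.ψ))).toReal with hEDUdef
  set EUD : ℝ := (eform v L (plainUp m L n (plainDown m L n Ψ.ψ))).toReal with hEUDdef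
  set S : ℝ := ∑ i : Fin 3, ((n i : ℝ)) ^ 2 with hSdef
  set D : ℝ := plainInteractionDefect v m L n Ψ.ψ with hDdef
  -- (kin)
  have kin : k0 * S * (Ma - Mb) ≤ 3 * (k0 * q) * (Ma + Mb) := by
    have f1 : 0 ≤ k0 * S * Mb := by positivity
    have f2 : k0 * Ma * S ≤ k0 * Ma * (3 * q) := mul_le_mul_of_nonneg_left hS (by positivity)
    have f3 : 0 ≤ k0 * q * Mb := by positivity
    linarith only [f1, f2, f3]
  -- (int)
  have hEN : E ≤ N * ρ * (nv + 1) := by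
    have h1 : N ^ 2 / L ^ 3 = N * ρ := by rw [hρdef]; ring
    have h2 : e₀ ≤ N * ρ * nv := by rw [← h1]; exact he₀
    have h3 : δr ≤ N * ρ := by rw [← h1]; exact hδN
    linarith only [hEle, h2, h3, hnv]
  have int : D ≤ C_I * (1 + Real.sqrt (nv + 1)) * ρ := by
    have h1 := PlainCost.sqrt_div_le_of_energy hρ.le hN hEN
    have h2 : C_I * (ρ + Real.sqrt (ρ * E / N)) ≤ C_I * (ρ + ρ * Real.sqrt (nv + 1)) :=
      mul_le_mul_of_nonneg_left (by linarith only [h1]) hC_I.le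
    calc D ≤ C_I * (ρ + Real.sqrt (ρ * E / N)) := hint'
      _ ≤ C_I * (ρ + ρ * Real.sqrt (nv + 1)) := h2
      _ = C_I * (1 + Real.sqrt (nv + 1)) * ρ := by ring
  -- (cross)
  have hQ : E - e₀ ≤ δr := by linarith only [hEle]
  have hbud : ∀ {X Y M : ℝ}, 0 ≤ M → X ≤ Kr * (Y + (1 + q) * M) → Y ≤ Kr * (E + (1 + q)) → M ≤ Kr →
      X ≤ Kr ^ 2 * (e₀ + 3) * (1 + q) := by
    intro X Y M hM hX hY hM'
    have h1 : (1 + q) * M ≤ (1 + q) * Kr := mul_le_mul_of_nonneg_left hM' (by linarith only [hq0])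
    have h2 : Y + (1 + q) * M ≤ Kr * (E + (1 + q)) + (1 + q) * Kr := by linarith only [h1, hY]
    have h3 : Kr * (Y + (1 + q) * M) ≤ Kr * (Kr * (E + (1 + q)) + (1 + q) * Kr) :=
      mul_le_mul_of_nonneg_left h2 hKr
    have h4 : E + (1 + q) + (1 + q) ≤ (e₀ + 3) * (1 + q) := by
      linarith only [hEle, hδ1, mul_nonneg he₀0 hq0, hq0]
    have h5 : Kr * (Kr * (E + (1 + q)) + (1 + q) * Kr) ≤ Kr ^ 2 * (e₀ + 3) * (1 + q) := by
      linarith only [mul_le_mul_of_nonneg_left h4 (mul_nonneg hKr hKr)]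
    linarith only [hX, h3, h5]
  have cross1 : Real.sqrt (EDU * (E - e₀)) ≤ ρ + k0 * q := by
    have h := PlainCost.sqrt_mul_le_of_slack hEDU0 (hbud hMa0 hEDU hEa hMa) hQ hδr.le hδε hε.le hq0
    have h2 : q * ε ≤ q * k0 := mul_le_mul_of_nonneg_left hεk hq0
    linarith only [h, hερ, h2]
  have cross2 : Real.sqrt (EUD * (E - e₀)) ≤ ρ + k0 * q := by
    have h := PlainCost.sqrt_mul_le_of_slack hEUD0 (hbud hMb0 hEUD hEb hMb) hQ hδr.le hδε hε.le hq0
    have h2 : q * ε ≤ q * k0 := mul_le_mul_of_nonneg_left hεk hq0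
    linarith only [h, hερ, h2]
  have g1 : 0 ≤ k0 * q * (Ma + Mb) := by positivity
  have g2 : 0 ≤ (C_I * (1 + Real.sqrt (nv + 1)) + 2) * ρ * (Ma + Mb) := by positivity
  have g3 : 0 ≤ k0 * q := by positivity
  linarith only [core, kin, int, cross1, cross2, g1, g2, g3]

/-- **Part 4 of `stub_bandEmptinessInt` (registered helper statement)**: the second variation of the plain pair at
near-minimisers for every admissible profile FINITE on `[0, ∞)` with INTEGRABLE lift (`v` measurable of finite range,
`v r < ∞` for `r ≥ 0`, `∫_{ℝ³} v(|x|) dx < ∞`; in particular the square-integrable class of skeleton v7) — constants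
`c₁, c₂` (after `v`) such that at every `(N, L)` with `E₀ < ∞` some slack `δ > 0` gives, for every `δ`-near-minimiser `Ψ`
and every mode `n`, `𝓔(ζ₊) + 𝓔(ζ₋) ≤ E₀(‖ζ₊‖² + ‖ζ₋‖²) + (c₁k² + c₂ρ)(1 + ‖ζ₊‖² + ‖ζ₋‖²)` (`ζ₊ = plainUp n Ψ`,
`ζ₋ = plainDown n Ψ`, `k = 2π‖n‖/L`, `ρ = N/L³`) — the conclusion of `PlainPairCost` without boundedness of the profile.
[folklore] (KennedyLiebShastry1988 (12)–(14); PitaevskiiStringari1991; LSSY2005 App. A) -/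
theorem plainPairCostInt_cost : ∀ (v : ℝ → ENNReal), Literature.MathematicalPhysics.QuantumManyBody.BoseGas.IsRepulsiveFiniteRange v → (∀ r : ℝ, 0 ≤ r → v r ≠ ⊤) → (∫⁻ x : Literature.MathematicalPhysics.QuantumManyBody.BoseGas.Space, v ‖x‖) ≠ ⊤ → ∃ c₁ c₂ : ℝ, 0 < c₁ ∧ 0 < c₂ ∧ ∀ (m : ℕ) (L : ℝ), 0 < L → Literature.MathematicalPhysics.QuantumManyBody.BoseGas.periodicGroundStateEnergy v (m + 1) L ≠ ⊤ → ∃ δ : ENNReal, 0 < δ ∧ ∀ Ψ : Literature.MathematicalPhysics.QuantumManyBody.BoseGas.PeriodicTrialState (m + 1) L, Literature.MathematicalPhysics.QuantumManyBody.BoseGas.periodicEnergy v Ψ ≤ Literature.MathematicalPhysics.QuantumManyBody.BoseGas.periodicGroundStateEnergy v (m + 1) L + δ → ∀ n : Fin 3 → ℤ, Summit.AtomisticToContinuum.BoseEinsteinCondensation.Cruxes.GDTransfer.DysonDressedWitness.eform v L (Summit.AtomisticToContinuum.BoseEinsteinCondensation.Cruxes.GDTransfer.Seeded.plainUp m L n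 Ψ.ψ) + Summit.AtomisticToContinuum.BoseEinsteinCondensation.Cruxes.GDTransfer.DysonDressedWitness.eform v L (Summit.AtomisticToContinuum.BoseEinsteinCondensation.Cruxes.GDTransfer.Seeded.plainDown m L n Ψ.ψ) ≤ Literature.MathematicalPhysics.QuantumManyBody.BoseGas.periodicGroundStateEnergy v (m + 1) L * (Summit.AtomisticToContinuum.BoseEinsteinCondensation.Cruxes.GDTransfer.DysonDressedWitness.mass L (Summit.AtomisticToContinuum.BoseEinsteinCondensation.Cruxes.GDTransfer.Seeded.plainUp m L n Ψ.ψ) + Summit.AtomisticToContinuum.BoseEinsteinCondensation.Cruxes.GDTransfer.DysonDressedWitness.mass L (Summit.AtomisticToContinuum.BoseEinsteinCondensation.Cruxes.GDTransfer.Seeded.plainDown m L n Ψ.ψ)) + ENNReal.ofReal ((c₁ * (2 * Real.pi * ‖(fun j => (n j : ℝ))‖ / L) ^ 2 + c₂ * (((m + 1 : ℕ) : ℝ) / L ^ 3)) * (1 + (Summit.AtomisticToContinuum.BoseEinsteinCondensation.Cruxes.GDTransfer.DysonDressedWitness.mass L (Summit.AtomisticToContinuum.BoseEinsteinCondensation.Cruxes.GDTransfer.Seeded.plainUp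 m L n Ψ.ψ) + Summit.AtomisticToContinuum.BoseEinsteinCondensation.Cruxes.GDTransfer.DysonDressedWitness.mass L (Summit.AtomisticToContinuum.BoseEinsteinCondensation.Cruxes.GDTransfer.Seeded.plainDown m L n Ψ.ψ)).toReal)) :=
  fun _ hv hfin hint => plainPairCost_int hv hfin hint

end Summit.AtomisticToContinuum.BoseEinsteinCondensation.Cruxes.GDTransfer.Seeded

end
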